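import Summits.ResolutionOfSingularities.ResolutionOfSingularities.Theorems.FrobeniusClosingPatchingRelPerfectDepthPhaseCLocalGameHolds
import HarnessLib

/-!
# Crux `PatchingRelPerfect` (stmt-ResolutionOfSingularities-16161), chain W5.2 — F7(β) (β-AX) C-I, (G): THE ENGINE SHELL —
# the locally monomial game from a ONE-STEP order reduction lowering a well-founded measure

[OURS · L1 W5.2 · F7(β) (β-AX) X3 C-I (G) (res-L1-w52-plan-1 g12 RULINGS G12-41 (5) / G12-49 (3): (G-T) `EndOrderReduction m` is OPEN; its proof design of
record is the Bierstone–Milman binomial blueprint, a lexicographic invariant lowered by each prescribed blow-up — res-D-pv-046 K24)] Fact-free; def-free;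
NOT statements of the manuscript under review (Hironaka 2017); AI-written, weaker than expert review.

What this file fixes once and for all is the LOOP: whoever proves the ONE-STEP statement «a locally-END ideal of order `≤ m` with `Sing(K, m) ≠ ∅` admits ONE
blowing up at a regular centre over its cosupport, factoring `K𝒪 = (C𝒪)^m · K₁` with `K₁` again locally END of order `≤ m`, the top regular Noetherian, and a
well-founded MEASURE strictly smaller» gets `X3LemmaM.LocallyMonomialGame` (hence `PhaseCOne CylReach` modulo the cures, `…LocalGameHolds`) by name.

* `exists_principalization_of_orderReductionLP_le` — the (G-A) descending induction with the exceptional factor only LOCALLY PRINCIPAL and the first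
  tower΄s centres only over `cosupp K` (all that (G-A) uses).
* `orderReductionLP_of_step` — THE WELL-FOUNDED LOOP on an arbitrary measure `μ K 𝓛 : α`, `[WellFoundedLT α]`: the one-step hypothesis for `m`
  gives marked order reduction for `m` (LP factor, centres over `cosupp K`).
* `locallyMonomialGame_of_step` — **`X3LemmaM.LocallyMonomialGame` from the one-step hypotheses for all `m ≥ 1`** (with `E := X3LemmaM.IsEndNear`, the
  order bound by `exists_idealOrder_le_of_locally_monomialSum`).

## References
* E. Bierstone, P. Milman, *Desingularization of toric and binomial varieties*, J. Algebraic Geom. 15 (2006), §8 (Thm. 8.5, Lemma 8.7, Def. 8.8).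
  [BierstoneMilman2006]
* J. Kollár, *Lectures on Resolution of Singularities* (2007), 3.109, (3.111) Step 3. [Kollar2007]
-/

-- `Summit.<Summit>.<Sub>.Theorems` with `Sub = Summit` (single-conjunct summit, D-0017)
set_option linter.dupNamespace false

noncomputable section

open CategoryTheory CategoryTheory.Limits AlgebraicGeometry TopologicalSpace IsLocalRing
open Literature.AlgebraicGeometry.Resolution Scheme.IdealSheafData

namespace Summit.ResolutionOfSingularities.ResolutionOfSingularities.Theorems

universe u v

namespace X3LocalGame

open DepthTargets

variable (E : ∀ ⦃Y : Scheme.{u}⦄, Y.IdealSheafData → List Y.IdealSheafData → Y → Prop)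

/-! ## §1 The descending induction, locally-principal factor -/

/-- [OURS · L1 W5.2 · C-I (G)] **The (G-A) induction with a locally principal factor**: marked order reduction for every `m ≥ 1` — a regular-centre
tower over `cosupp K` with regular Noetherian top, `K𝒪 = M·K₁`, `M` LOCALLY PRINCIPAL, `ord K₁ < m`, `K₁` locally END over `cosupp K` — principalises
every `E`-locally-END ideal of order `≤ m`. [cite: Kollar2007, 3.109, (3.111) Step 3] -/
theorem exists_principalization_of_orderReductionLP_le
    (hred : ∀ m : ℕ, 1 ≤ m → ∀ (X : Scheme.{u}) [IsNoetherian X], Scheme.IsRegular X →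
      ∀ (K : X.IdealSheafData) (𝓛 : List X.IdealSheafData),
        (∀ x ∈ (K.support : Set X), E K 𝓛 x) → (∀ x : X, idealOrder K x ≤ (m : ℕ∞)) →
          ∃ s : CentreSeq X, s.AllRegular ∧ s.CentresOver (K.support : Set X) ∧ Scheme.IsRegular s.top ∧
            ∃ (_ : IsNoetherian s.top) (M K₁ : s.top.IdealSheafData) (𝓛₁ : List s.top.IdealSheafData),
              K.comap s.comp = M * K₁ ∧ IsLocallyPrincipal M ∧
              (∀ x : s.top, idealOrder K₁ x < (m : ℕ∞)) ∧
              (∀ x ∈ (K₁.support : Set s.top), E K₁ 𝓛₁ x) ∧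
              (K₁.support : Set s.top) ⊆ s.comp ⁻¹' (K.support : Set X)) :
    ∀ (m : ℕ) (X : Scheme.{u}) [IsNoetherian X], Scheme.IsRegular X →
      ∀ (K : X.IdealSheafData) (𝓛 : List X.IdealSheafData),
        (∀ x ∈ (K.support : Set X), E K 𝓛 x) → (∀ x : X, idealOrder K x ≤ (m : ℕ∞)) →
          ∃ s : CentreSeq X, s.AllRegular ∧ s.CentresOver (K.support : Set X) ∧
            Scheme.IsRegular s.top ∧ IsLocallyPrincipal (K.comap s.comp) := by
  intro m
  induction m with
  | zero =>
    intro X _ hX K 𝓛 _ hord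
    have hK : K = ⊤ := eq_top_of_idealOrder_le_zero K hord
    refine ⟨CentreSeq.nil X, trivial, trivial, hX, ?_⟩
    rw [hK, Scheme.IdealSheafData.comap_top]
    exact isLocallyPrincipal_top _
  | succ m ih =>
    intro X _ hX K 𝓛 hE hord
    obtain ⟨s₁, hreg₁, hover₁, htop₁, hN₁, M, K₁, 𝓛₁, hKM, hM, hord₁, hE₁, hsupp₁⟩ :=
      hred (m + 1) (Nat.succ_le_succ (Nat.zero_le m)) X hX K 𝓛 hE hord
    haveI := hN₁
    have hord₁' : ∀ x : s₁.top, idealOrder K₁ x ≤ (m : ℕ∞) := fun x => by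
      have h := hord₁ x
      rw [Nat.cast_succ] at h
      exact Order.le_of_lt_add_one h
    obtain ⟨s₂, hreg₂, hover₂, htop₂, hlp₂⟩ := ih s₁.top htop₁ K₁ 𝓛₁ hE₁ hord₁'
    refine ⟨s₁.append s₂, (CentreSeq.allRegular_append_iff s₁ s₂).mpr ⟨hreg₁, hreg₂⟩,
      (CentreSeq.centresOver_append_iff s₁ s₂ _).mpr ⟨hover₁, CentreSeq.CentresOver.mono s₂ hsupp₁ hover₂⟩, ?_, ?_⟩
    · rw [CentreSeq.top_append]
      exact htop₂
    · rw [CentreSeq.comp_append, ChainW52F7BetaR.isLocallyPrincipal_comap_eqToHom_comp_iff, Scheme.IdealSheafData.comap_comp, hKM,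
        comap_mul]
      exact (hM.comap s₂.comp).mul hlp₂

/-! ## §2 The well-founded loop -/

section Loop

variable {α : Type v} [Preorder α] [WellFoundedLT α] (μ : ∀ ⦃Y : Scheme.{u}⦄, Y.IdealSheafData → List Y.IdealSheafData → α)

/-- [OURS · L1 W5.2 · C-I (G)] **THE ENGINE SHELL — one step lowering a well-founded measure gives marked order reduction.**  Hypothesis (the
(G-T) prover΄s ONE-STEP target, Bierstone–Milman Thm. 8.5 style): for a locally-END `K` of order `≤ m` everywhere on a regular Noetherian `X` with
`Sing(K, m) ≠ ∅`, ONE blowing up at a regular centre `C` over `cosupp K` with `Bl_C X` regular Noetherian and `K𝒪 = (C𝒪)^m · K₁`, `K₁` locally END of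
order `≤ m` with `cosupp K₁` over `cosupp K`, and `μ K₁ 𝓛₁ < μ K 𝓛`.  Conclusion: a regular-centre tower over `cosupp K`, regular Noetherian top,
`K𝒪 = M·K₁` with `M` locally principal, `ord K₁ < m` everywhere, `K₁` locally END, `cosupp K₁` over `cosupp K`.
[cite: BierstoneMilman2006, Thm. 8.5] [cite: Kollar2007, 3.109] -/
theorem orderReductionLP_of_step (m : ℕ)
    (hstep : ∀ (X : Scheme.{u}) [IsNoetherian X], Scheme.IsRegular X →
      ∀ (K : X.IdealSheafData) (𝓛 : List X.IdealSheafData),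
        (∀ x ∈ (K.support : Set X), E K 𝓛 x) → (∀ x : X, idealOrder K x ≤ (m : ℕ∞)) →
        (⟨K, [], m⟩ : MarkedIdeal X).support.Nonempty →
          ∃ C : X.IdealSheafData, Scheme.IsRegular C.subscheme ∧ (C.support : Set X) ⊆ (K.support : Set X) ∧
            Scheme.IsRegular (blowup C) ∧
            ∃ (_ : IsNoetherian (blowup C)) (K₁ : (blowup C).IdealSheafData) (𝓛₁ : List (blowup C).IdealSheafData),
              K.comap (blowup.π C) = (C.comap (blowup.π C)) ^ m * K₁ ∧
              (∀ x : blowup C, idealOrder K₁ x ≤ (m : ℕ∞)) ∧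
              (∀ x ∈ (K₁.support : Set (blowup C)), E K₁ 𝓛₁ x) ∧
              (K₁.support : Set (blowup C)) ⊆ blowup.π C ⁻¹' (K.support : Set X) ∧
              μ K₁ 𝓛₁ < μ K 𝓛) :
    ∀ (X : Scheme.{u}) [IsNoetherian X], Scheme.IsRegular X →
      ∀ (K : X.IdealSheafData) (𝓛 : List X.IdealSheafData),
        (∀ x ∈ (K.support : Set X), E K 𝓛 x) → (∀ x : X, idealOrder K x ≤ (m : ℕ∞)) →
          ∃ s : CentreSeq X, s.AllRegular ∧ s.CentresOver (K.support : Set X) ∧ Scheme.IsRegular s.top ∧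
            ∃ (_ : IsNoetherian s.top) (M K₁ : s.top.IdealSheafData) (𝓛₁ : List s.top.IdealSheafData),
              K.comap s.comp = M * K₁ ∧ IsLocallyPrincipal M ∧
              (∀ x : s.top, idealOrder K₁ x < (m : ℕ∞)) ∧
              (∀ x ∈ (K₁.support : Set s.top), E K₁ 𝓛₁ x) ∧
              (K₁.support : Set s.top) ⊆ s.comp ⁻¹' (K.support : Set X) := by
  -- well-founded induction on the measure
  suffices H : ∀ (a : α) (X : Scheme.{u}) [IsNoetherian X], Scheme.IsRegular X →
      ∀ (K : X.IdealSheafData) (𝓛 : List X.IdealSheafData), μ K 𝓛 = a →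
        (∀ x ∈ (K.support : Set X), E K 𝓛 x) → (∀ x : X, idealOrder K x ≤ (m : ℕ∞)) →
          ∃ s : CentreSeq X, s.AllRegular ∧ s.CentresOver (K.support : Set X) ∧ Scheme.IsRegular s.top ∧
            ∃ (_ : IsNoetherian s.top) (M K₁ : s.top.IdealSheafData) (𝓛₁ : List s.top.IdealSheafData),
              K.comap s.comp = M * K₁ ∧ IsLocallyPrincipal M ∧
              (∀ x : s.top, idealOrder K₁ x < (m : ℕ∞)) ∧
              (∀ x ∈ (K₁.support : Set s.top), E K₁ 𝓛₁ x) ∧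
              (K₁.support : Set s.top) ⊆ s.comp ⁻¹' (K.support : Set X) from
    fun X _ hX K 𝓛 hE hord => H (μ K 𝓛) X hX K 𝓛 rfl hE hord
  intro a
  induction a using WellFoundedLT.induction with
  | ind a ih =>
    intro X _ hX K 𝓛 ha hE hord
    by_cases hsing : ((⟨K, [], m⟩ : MarkedIdeal X).support).Nonempty
    · -- ONE STEP, then recurse on the smaller measure
      obtain ⟨C, hCreg, hCK, htopreg, hN, K₁, 𝓛₁, hKC, hord₁, hE₁, hsupp₁, hμ⟩ := hstep X hX K 𝓛 hE hord hsing
      haveI := hN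
      obtain ⟨s', hreg', hover', htop', hN', M', K₁', 𝓛₁', hK', hM', hord', hE', hsupp'⟩ :=
        ih (μ K₁ 𝓛₁) (ha ▸ hμ) (blowup C) htopreg K₁ 𝓛₁ rfl hE₁ hord₁
      refine ⟨CentreSeq.cons C s', (CentreSeq.allRegular_cons C s').mpr ⟨hCreg, hreg'⟩,
        (CentreSeq.centresOver_cons C s' _).mpr ⟨hCK, CentreSeq.CentresOver.mono s' hsupp₁ hover'⟩, htop', hN',
        ((C.comap (blowup.π C)) ^ m).comap s'.comp * M', K₁', 𝓛₁', ?_, ?_, hord', hE', fun x hx => hsupp₁ (hsupp' hx)⟩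
      · -- `K𝒪 = ((C𝒪)^m 𝒪) · M′ · K₁′`
        show K.comap (s'.comp ≫ blowup.π C) = ((C.comap (blowup.π C)) ^ m).comap s'.comp * M' * K₁'
        rw [Scheme.IdealSheafData.comap_comp, hKC, comap_mul, hK', mul_assoc]
      · exact (((blowup.isBlowup C).isEffectiveCartier.isLocallyPrincipal.pow m).comap s'.comp).mul hM'
    · -- `Sing(K, m) = ∅`: nothing to do
      refine ⟨CentreSeq.nil X, trivial, trivial, hX, inferInstanceAs (IsNoetherian X), ⊤, K, 𝓛, ?_, isLocallyPrincipal_top _,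
        fun x => ?_, hE, fun x hx => hx⟩
      · show K.comap (𝟙 X) = ⊤ * K
        rw [Scheme.IdealSheafData.comap_id, Scheme.IdealSheafData.top_mul]
      · rw [Set.not_nonempty_iff_eq_empty] at hsing
        have hx : x ∉ (⟨K, [], m⟩ : MarkedIdeal X).support := by rw [hsing]; exact id
        exact not_le.mp hx

end Loop

/-! ## §3 The locally monomial game from the one-step hypotheses -/

/-- [OURS · L1 W5.2 · C-I (G)] **`X3LemmaM.LocallyMonomialGame` FROM THE ONE-STEP ORDER REDUCTIONS**: if for every `m ≥ 1` some well-founded measure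
is lowered by one legal blowing up of every locally-END ideal of maximal order `m` (Bierstone–Milman Thm. 8.5 pattern), the locally monomial game holds
(so `PhaseCOne CylReach` follows modulo the cures, `X3LemmaM.phaseCOne_cylReach_of_endOrderReduction`-style). [cite: BierstoneMilman2006, Thm. 8.5]
[cite: Kollar2007, (3.111) Step 3] -/
theorem locallyMonomialGame_of_step {α : Type v} [Preorder α] [WellFoundedLT α]
    (μ : ∀ ⦃Y : Scheme.{u}⦄, Y.IdealSheafData → List Y.IdealSheafData → α)
    (hstep : ∀ m : ℕ, 1 ≤ m → ∀ (X : Scheme.{u}) [IsNoetherian X], Scheme.IsRegular X →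
      ∀ (K : X.IdealSheafData) (𝓛 : List X.IdealSheafData),
        (∀ x ∈ (K.support : Set X), X3LemmaM.IsEndNear K 𝓛 x) → (∀ x : X, idealOrder K x ≤ (m : ℕ∞)) →
        (⟨K, [], m⟩ : MarkedIdeal X).support.Nonempty →
          ∃ C : X.IdealSheafData, Scheme.IsRegular C.subscheme ∧ (C.support : Set X) ⊆ (K.support : Set X) ∧
            Scheme.IsRegular (blowup C) ∧
            ∃ (_ : IsNoetherian (blowup C)) (K₁ : (blowup C).IdealSheafData) (𝓛₁ : List (blowup C).IdealSheafData),
              K.comap (blowup.π C) = (C.comap (blowup.π C)) ^ m * K₁ ∧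
              (∀ x : blowup C, idealOrder K₁ x ≤ (m : ℕ∞)) ∧
              (∀ x ∈ (K₁.support : Set (blowup C)), X3LemmaM.IsEndNear K₁ 𝓛₁ x) ∧
              (K₁.support : Set (blowup C)) ⊆ blowup.π C ⁻¹' (K.support : Set X) ∧
              μ K₁ 𝓛₁ < μ K 𝓛) :
    X3LemmaM.LocallyMonomialGame.{u} := by
  intro Y _ _ hY _ K _ hgood
  obtain ⟨𝓛, h𝓛⟩ := hgood
  -- the order bound for locally monomial ideals
  obtain ⟨m, hm⟩ := exists_idealOrder_le_of_locally_monomialSum K fun x hx => by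
    obtain ⟨Λ, -, U, hxU, hsnc, 𝒦, hbd, hne, hK⟩ := h𝓛 x hx
    exact ⟨U, hxU, Λ, 𝒦, hsnc, hbd, hne, hK⟩
  exact exists_principalization_of_orderReductionLP_le (fun Y K 𝓛 x => X3LemmaM.IsEndNear K 𝓛 x)
    (fun m hm => orderReductionLP_of_step (fun Y K 𝓛 x => X3LemmaM.IsEndNear K 𝓛 x) μ m (hstep m hm)) m Y hY K 𝓛 h𝓛 hm

end X3LocalGame

end Summit.ResolutionOfSingularities.ResolutionOfSingularities.Theorems

end
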